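import Summits.QuantumFields.YangMills.Theorems.InfiniteVolumeTorusScheme
import Summits.QuantumFields.YangMills.Theorems.LangevinControlUVOSLegsFromFemtoAndGapStubAssemblyShiftDefect
import HarnessLib

/-!
# Infinite volume by compactness, step 10: the `O(a)` shift defect of the infinite-volume series, and the torus
# junction with plaquette-CENTRE smearing

HONEST FRAMING (cell `ym-fleet`, seat `ym-infvol-p2`, director-ym R136 (i) «INFINITE-VOLUME ∕ CONTINUUM-FROM-UV
ROUTE»; hook for support `IVEuclideanInvariance` of the planner's DESIGN 2026-08-26T17:44:53Z (seat p1 lead);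
bears on LADDER-YM R1∕R2a).  Pure soft analysis, kernel-checked; the only Yang–Mills input is the spine's UV-leg
currency `MomentBounds6 G r a` (HYPOTHESIS).  Nothing about rotations themselves, reflection positivity, uniqueness,
a mass gap, or Clay.

WHY.  The route's DATA clause smears at plaquette CENTRES `a·x_l + (a/2)(e_{(q l).1} + e_{(q l).2})`; the spine's torus
distributions `latticeDistStr` (hence `ROT`'s `LatticeRotWard`) smear at base points `a·x_l`.  The difference is a
constant shift of size `≤ a` per argument; on `⁰𝒮ₙ` the infinite-volume series changes by `O(a)` (mean value theorem
+ the a-uniform bound of step 2 applied to the directional derivative, exactly as the spine's toolkit XVI on the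
torus).  Combined with the base-point junction of step 6 this gives the junction for centre smearing.

WHAT IS PROVED ([folklore] throughout).
* §1 **`sum_abs_weight_shift_sub_le_of_zdCollar`** (abstract `ℤ⁴`-collar weights, finite `T`):
  `Σ_{x∈T} |W x|·‖G(y x + c) − G(y x)‖ ≤ 2‖c‖·Kⁿ·Σ⁺(G)` for shifts `‖(y x)_l − a x_l‖ ≤ s₁a`, `‖c_l‖ ≤ s₂a`,
  `s₁ + s₂ ≤ 6`, `(s₁+s₂)a ≤ 1/4`; `norm_tsum_weight_shift_sub_le_of_zdCollar` (series form);
  `budget_succ_le_schwartzNorm` (`Σ⁺(G) ≤ 5‖G‖_{10n+1}`).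
* §2 **`tendsto_tsum_centre_sub_base`** — for odd-torus limit states `μ_k` (`MomentBounds6`, `β_k ≥ β₄`,
  `0 < a_k ≤ min (1/24) ℓ₄`, `a_k → 0`): the centre-smeared minus the base-point-smeared infinite-volume series
  `→ 0` on `⁰𝒮ₙ`; **`exists_torusSides_approximating_centre`** — step 6's junction with the infinite-volume series
  read at plaquette CENTRES: torus sides `L_k ≥ g k` (≥ 14, ≥ a_k⁻²) with
  `latticeDistStr r.ρ β_k L_k a_k (planes q) (means) F − Σ'ₓ W_{μ_k}(q,x)·F(centres) → 0`.

References: Glimm–Jaffe (1987) §6.1; Osterwalder–Schrader CMP 42 (1975) §2.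
-/

set_option autoImplicit false

noncomputable section

open scoped BigOperators SchwartzMap LineDeriv
open MeasureTheory Filter Topology Set
open Literature.MathematicalPhysics.QuantumFieldTheory hiding ZdEdge
open Literature.MathematicalPhysics.QuantumLattice
open Literature.MathematicalPhysics.AQFT
open Literature.Probability.LatticeModels (box Site)
open Summit.QuantumFields.YangMills.Cruxes.OSLegsFromFemtoAndGap.DlrCollarTransfer
  (plane torusE MomentBounds6 exists_abs_plane_le)
open Summit.QuantumFields.YangMills.Theorems.OSLegsFromFemtoAndGap
  (torusMomentStr latticeDistStr norm_sub_le_lineDeriv budget_lineDeriv_le)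

namespace Summit.QuantumFields.YangMills.Theorems.InfiniteVolume

/-! ## §1 The shift defect for `ℤ⁴`-collar weights -/

section Abstract

variable {n : ℕ}

/-- **The shift defect is `O(‖c‖)`, infinite volume, absolute, every finite `T`.**  Abstract weights with sup bound
`Mⁿ` and `ℤ⁴`-collar bound; base points within `s₁a`, constant shift `‖c_l‖ ≤ s₂a`, `s₁+s₂ ≤ 6`, `(s₁+s₂)a ≤ 1/4`,
`G ∈ ⁰𝒮ₙ`: `Σ_{x∈T} |W x|·‖G(y x + c) − G(y x)‖ ≤ 2‖c‖·Kⁿ·Σ⁺(G)`. [folklore] -/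
theorem sum_abs_weight_shift_sub_le_of_zdCollar {C ℓ₄ M a s₁ s₂ : ℝ} (hℓ : 0 < ℓ₄) (hC : 0 ≤ C) (hM : 0 ≤ M)
    (W : (Fin n → Site 4) → ℝ) (hWsup : ∀ x, |W x| ≤ M ^ n)
    (H : ∀ (x : Fin n → Site 4) (R : ℕ), 1 ≤ R → (R : ℝ) * a ≤ ℓ₄ →
      (∀ i j : Fin n, i ≠ j → ∃ k : Fin 4, (2 * (R : ℤ) + 4) ≤ |x i k - x j k|) →
      |W x| ≤ (C / (R : ℝ) ^ 4) ^ n)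
    (ha : 0 < a) (ha1 : a ≤ 1) (haℓ : a ≤ ℓ₄) (hn : 2 ≤ n)
    (hs₁ : 0 ≤ s₁) (hs₂ : 0 ≤ s₂) (hs6 : s₁ + s₂ ≤ 6) (hsa : (s₁ + s₂) * a ≤ 1 / 4)
    (G : 𝓢((Fin n → EuclideanSpace ℝ (Fin 4)), ℂ)) (hG : IsOffDiagonal G)
    (y : (Fin n → Site 4) → (Fin n → EuclideanSpace ℝ (Fin 4)))
    (hyx : ∀ x l, ‖y x l - a • siteToE (x l)‖ ≤ s₁ * a)
    (c : Fin n → EuclideanSpace ℝ (Fin 4)) (hc : ∀ l, ‖c l‖ ≤ s₂ * a) (T : Finset (Fin n → Site 4)) :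
    ∑ x ∈ T, |W x| * ‖G (y x + c) - G (y x)‖ ≤
      2 * ‖c‖ * ((M * 4 ^ 4 * 5 ^ 6 + M * 2 ^ 6 * (10 + 2 * (s₁ + s₂)) ^ 4 + 16 * C * 2 ^ 6 * (2 / ℓ₄ + 48) ^ 4) *
          2 ^ 6 * (81 * ∑' m : ℕ, (((m : ℝ) + 1) ^ 2)⁻¹)) ^ n *
        (SchwartzMap.seminorm ℂ 0 (4 * n + 1) G + SchwartzMap.seminorm ℂ (6 * n) (4 * n + 1) G +
          SchwartzMap.seminorm ℂ 0 1 G + SchwartzMap.seminorm ℂ (6 * n) 1 G + SchwartzMap.seminorm ℂ (10 * n) 1 G) := by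
  classical
  have hmv := fun x : Fin n → Site 4 => norm_sub_le_lineDeriv G (y x) c
  choose τ₁ hτ₁ τ₂ hτ₂ hle using hmv
  have hshift : ∀ (τ : (Fin n → Site 4) → ℝ), (∀ x, τ x ∈ Ioo (0 : ℝ) 1) →
      ∀ x l, ‖(y x + τ x • c) l - a • siteToE (x l)‖ ≤ (s₁ + s₂) * a := by
    intro τ hτ x l
    have h1 : (y x + τ x • c) l - a • siteToE (x l) = (y x l - a • siteToE (x l)) + τ x • c l := by
      simp only [Pi.add_apply, Pi.smul_apply]; abel
    rw [h1]
    calc _ ≤ ‖y x l - a • siteToE (x l)‖ + ‖τ x • c l‖ := norm_add_le _ _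
      _ ≤ s₁ * a + s₂ * a := by
          refine add_le_add (hyx x l) ?_
          rw [norm_smul, Real.norm_of_nonneg (hτ x).1.le]
          calc τ x * ‖c l‖ ≤ 1 * ‖c l‖ := by gcongr; exact (hτ x).2.le
            _ ≤ s₂ * a := by rw [one_mul]; exact hc l
      _ = (s₁ + s₂) * a := by ring
  have hG' : IsOffDiagonal (∂_{c} G : 𝓢((Fin n → EuclideanSpace ℝ (Fin 4)), ℂ)) := hG.lineDeriv c
  have hs0 : 0 ≤ s₁ + s₂ := by positivity
  have hsum₁ := sum_abs_weight_mul_norm_le_of_zdCollar hℓ hC hM W hWsup H ha ha1 haℓ hn hs0 hs6 hsa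
    (∂_{c} G : 𝓢((Fin n → EuclideanSpace ℝ (Fin 4)), ℂ)) hG' (fun x => y x + τ₁ x • c) (hshift τ₁ hτ₁) T
  have hsum₂ := sum_abs_weight_mul_norm_le_of_zdCollar hℓ hC hM W hWsup H ha ha1 haℓ hn hs0 hs6 hsa
    (∂_{c} G : 𝓢((Fin n → EuclideanSpace ℝ (Fin 4)), ℂ)) hG' (fun x => y x + τ₂ x • c) (hshift τ₂ hτ₂) T
  set KK := ((M * 4 ^ 4 * 5 ^ 6 + M * 2 ^ 6 * (10 + 2 * (s₁ + s₂)) ^ 4 + 16 * C * 2 ^ 6 * (2 / ℓ₄ + 48) ^ 4) *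
    2 ^ 6 * (81 * ∑' m : ℕ, (((m : ℝ) + 1) ^ 2)⁻¹)) ^ n with hKK
  have hKK0 : 0 ≤ KK := by
    have : 0 ≤ ∑' m : ℕ, (((m : ℝ) + 1) ^ 2)⁻¹ := tsum_nonneg fun m => by positivity
    positivity
  have hbud := budget_lineDeriv_le G c
  calc ∑ x ∈ T, |W x| * ‖G (y x + c) - G (y x)‖
      ≤ ∑ x ∈ T, (|W x| * ‖(∂_{c} G : 𝓢((Fin n → EuclideanSpace ℝ (Fin 4)), ℂ)) (y x + τ₁ x • c)‖ +
          |W x| * ‖(∂_{c} G : 𝓢((Fin n → EuclideanSpace ℝ (Fin 4)), ℂ)) (y x + τ₂ x • c)‖) := by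
        refine Finset.sum_le_sum fun x _ => ?_
        rw [← mul_add]
        exact mul_le_mul_of_nonneg_left (hle x) (abs_nonneg _)
    _ = (∑ x ∈ T, |W x| * ‖(∂_{c} G : 𝓢((Fin n → EuclideanSpace ℝ (Fin 4)), ℂ)) (y x + τ₁ x • c)‖) +
        ∑ x ∈ T, |W x| * ‖(∂_{c} G : 𝓢((Fin n → EuclideanSpace ℝ (Fin 4)), ℂ)) (y x + τ₂ x • c)‖ :=
        Finset.sum_add_distrib
    _ ≤ KK * (SchwartzMap.seminorm ℂ 0 (4 * n) (∂_{c} G : 𝓢((Fin n → EuclideanSpace ℝ (Fin 4)), ℂ)) +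
          SchwartzMap.seminorm ℂ (6 * n) (4 * n) (∂_{c} G : 𝓢((Fin n → EuclideanSpace ℝ (Fin 4)), ℂ)) +
          SchwartzMap.seminorm ℂ 0 0 (∂_{c} G : 𝓢((Fin n → EuclideanSpace ℝ (Fin 4)), ℂ)) +
          SchwartzMap.seminorm ℂ (6 * n) 0 (∂_{c} G : 𝓢((Fin n → EuclideanSpace ℝ (Fin 4)), ℂ)) +
          SchwartzMap.seminorm ℂ (10 * n) 0 (∂_{c} G : 𝓢((Fin n → EuclideanSpace ℝ (Fin 4)), ℂ))) +
        KK * (SchwartzMap.seminorm ℂ 0 (4 * n) (∂_{c} G : 𝓢((Fin n → EuclideanSpace ℝ (Fin 4)), ℂ)) +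
          SchwartzMap.seminorm ℂ (6 * n) (4 * n) (∂_{c} G : 𝓢((Fin n → EuclideanSpace ℝ (Fin 4)), ℂ)) +
          SchwartzMap.seminorm ℂ 0 0 (∂_{c} G : 𝓢((Fin n → EuclideanSpace ℝ (Fin 4)), ℂ)) +
          SchwartzMap.seminorm ℂ (6 * n) 0 (∂_{c} G : 𝓢((Fin n → EuclideanSpace ℝ (Fin 4)), ℂ)) +
          SchwartzMap.seminorm ℂ (10 * n) 0 (∂_{c} G : 𝓢((Fin n → EuclideanSpace ℝ (Fin 4)), ℂ))) := add_le_add hsum₁ hsum₂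
    _ ≤ KK * (‖c‖ * (SchwartzMap.seminorm ℂ 0 (4 * n + 1) G + SchwartzMap.seminorm ℂ (6 * n) (4 * n + 1) G +
          SchwartzMap.seminorm ℂ 0 1 G + SchwartzMap.seminorm ℂ (6 * n) 1 G + SchwartzMap.seminorm ℂ (10 * n) 1 G)) +
        KK * (‖c‖ * (SchwartzMap.seminorm ℂ 0 (4 * n + 1) G + SchwartzMap.seminorm ℂ (6 * n) (4 * n + 1) G +
          SchwartzMap.seminorm ℂ 0 1 G + SchwartzMap.seminorm ℂ (6 * n) 1 G + SchwartzMap.seminorm ℂ (10 * n) 1 G)) := by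
        gcongr
    _ = _ := by ring

/-- `Σ⁺(G) ≤ 5·‖G‖_{10n+1}`. [folklore] -/
theorem budget_succ_le_schwartzNorm (G : 𝓢((Fin n → EuclideanSpace ℝ (Fin 4)), ℂ)) :
    SchwartzMap.seminorm ℂ 0 (4 * n + 1) G + SchwartzMap.seminorm ℂ (6 * n) (4 * n + 1) G +
        SchwartzMap.seminorm ℂ 0 1 G + SchwartzMap.seminorm ℂ (6 * n) 1 G + SchwartzMap.seminorm ℂ (10 * n) 1 G ≤
      5 * schwartzNorm (10 * n + 1) G := by
  have h1 := seminorm_le_schwartzNorm (m := 10 * n + 1) (k := 0) (l := 4 * n + 1) (by omega) (by omega) G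
  have h2 := seminorm_le_schwartzNorm (m := 10 * n + 1) (k := 6 * n) (l := 4 * n + 1) (by omega) (by omega) G
  have h3 := seminorm_le_schwartzNorm (m := 10 * n + 1) (k := 0) (l := 1) (by omega) (by omega) G
  have h4 := seminorm_le_schwartzNorm (m := 10 * n + 1) (k := 6 * n) (l := 1) (by omega) (by omega) G
  have h5 := seminorm_le_schwartzNorm (m := 10 * n + 1) (k := 10 * n) (l := 1) (by omega) (by omega) G
  linarith

/-- **Series form of the shift defect**: `‖Σ'ₓ W(x)·G(y x + c) − Σ'ₓ W(x)·G(y x)‖ ≤ 2‖c‖·Kⁿ·5‖G‖_{10n+1}`. [folklore] -/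
theorem norm_tsum_weight_shift_sub_le_of_zdCollar {C ℓ₄ M a s₁ s₂ : ℝ} (hℓ : 0 < ℓ₄) (hC : 0 ≤ C) (hM : 0 ≤ M)
    (W : (Fin n → Site 4) → ℝ) (hWsup : ∀ x, |W x| ≤ M ^ n)
    (H : ∀ (x : Fin n → Site 4) (R : ℕ), 1 ≤ R → (R : ℝ) * a ≤ ℓ₄ →
      (∀ i j : Fin n, i ≠ j → ∃ k : Fin 4, (2 * (R : ℤ) + 4) ≤ |x i k - x j k|) →
      |W x| ≤ (C / (R : ℝ) ^ 4) ^ n)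
    (ha : 0 < a) (ha1 : a ≤ 1) (haℓ : a ≤ ℓ₄) (hn : 2 ≤ n)
    (hs₁ : 0 ≤ s₁) (hs₂ : 0 ≤ s₂) (hs6 : s₁ + s₂ ≤ 6) (hsa : (s₁ + s₂) * a ≤ 1 / 4)
    (G : 𝓢((Fin n → EuclideanSpace ℝ (Fin 4)), ℂ)) (hG : IsOffDiagonal G)
    (y : (Fin n → Site 4) → (Fin n → EuclideanSpace ℝ (Fin 4)))
    (hyx : ∀ x l, ‖y x l - a • siteToE (x l)‖ ≤ s₁ * a)
    (c : Fin n → EuclideanSpace ℝ (Fin 4)) (hc : ∀ l, ‖c l‖ ≤ s₂ * a) :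
    ‖∑' x : Fin n → Site 4, ((W x : ℝ) : ℂ) * G (y x + c) - ∑' x : Fin n → Site 4, ((W x : ℝ) : ℂ) * G (y x)‖ ≤
      2 * ‖c‖ * ((M * 4 ^ 4 * 5 ^ 6 + M * 2 ^ 6 * (10 + 2 * (s₁ + s₂)) ^ 4 + 16 * C * 2 ^ 6 * (2 / ℓ₄ + 48) ^ 4) *
          2 ^ 6 * (81 * ∑' m : ℕ, (((m : ℝ) + 1) ^ 2)⁻¹)) ^ n * (5 * schwartzNorm (10 * n + 1) G) := by
  set KK := ((M * 4 ^ 4 * 5 ^ 6 + M * 2 ^ 6 * (10 + 2 * (s₁ + s₂)) ^ 4 + 16 * C * 2 ^ 6 * (2 / ℓ₄ + 48) ^ 4) *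
    2 ^ 6 * (81 * ∑' m : ℕ, (((m : ℝ) + 1) ^ 2)⁻¹)) ^ n with hKK
  have hKK0 : 0 ≤ KK := by
    have : 0 ≤ ∑' m : ℕ, (((m : ℝ) + 1) ^ 2)⁻¹ := tsum_nonneg fun m => by positivity
    positivity
  -- both shifted and unshifted evaluation maps are within `6a`
  have hsa₁ : s₁ * a ≤ 1 / 4 := le_trans (by nlinarith [ha.le]) hsa
  have hy' : ∀ x l, ‖(y x + c) l - a • siteToE (x l)‖ ≤ (s₁ + s₂) * a := fun x l => by
    have h1 : (y x + c) l - a • siteToE (x l) = (y x l - a • siteToE (x l)) + c l := by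
      simp only [Pi.add_apply]; abel
    rw [h1]
    calc _ ≤ ‖y x l - a • siteToE (x l)‖ + ‖c l‖ := norm_add_le _ _
      _ ≤ s₁ * a + s₂ * a := add_le_add (hyx x l) (hc l)
      _ = (s₁ + s₂) * a := by ring
  have hB : 0 ≤ M ^ n := pow_nonneg hM n
  have hsum1 := summable_mul_of_bounded ha ha1 hsa hB W hWsup G (fun x => y x + c) hy'
  have hsum2 := summable_mul_of_bounded ha ha1 hsa₁ hB W hWsup G y hyx
  rw [← Summable.tsum_sub hsum1 hsum2]
  have hnorm : ∀ x : Fin n → Site 4, ‖((W x : ℝ) : ℂ) * G (y x + c) - ((W x : ℝ) : ℂ) * G (y x)‖ =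
      |W x| * ‖G (y x + c) - G (y x)‖ := fun x => by
    rw [← mul_sub, norm_mul, Complex.norm_real, Real.norm_eq_abs]
  have hle := sum_abs_weight_shift_sub_le_of_zdCollar hℓ hC hM W hWsup H ha ha1 haℓ hn hs₁ hs₂ hs6 hsa G hG y hyx
    c hc
  have hsumm : Summable fun x : Fin n → Site 4 => |W x| * ‖G (y x + c) - G (y x)‖ :=
    summable_of_sum_le (fun x => by positivity) hle
  calc ‖∑' x : Fin n → Site 4, (((W x : ℝ) : ℂ) * G (y x + c) - ((W x : ℝ) : ℂ) * G (y x))‖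
      ≤ ∑' x : Fin n → Site 4, ‖((W x : ℝ) : ℂ) * G (y x + c) - ((W x : ℝ) : ℂ) * G (y x)‖ :=
        norm_tsum_le_tsum_norm (by simpa [hnorm] using hsumm)
    _ = ∑' x : Fin n → Site 4, |W x| * ‖G (y x + c) - G (y x)‖ := by simp_rw [hnorm]
    _ ≤ 2 * ‖c‖ * KK * (SchwartzMap.seminorm ℂ 0 (4 * n + 1) G + SchwartzMap.seminorm ℂ (6 * n) (4 * n + 1) G +
          SchwartzMap.seminorm ℂ 0 1 G + SchwartzMap.seminorm ℂ (6 * n) 1 G + SchwartzMap.seminorm ℂ (10 * n) 1 G) :=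
        Real.tsum_le_of_sum_le (fun x => by positivity) hle
    _ ≤ 2 * ‖c‖ * KK * (5 * schwartzNorm (10 * n + 1) G) := by
        gcongr
        exact budget_succ_le_schwartzNorm G

end Abstract

/-! ## §2 Centre versus base-point smearing; the torus junction at plaquette centres -/

section Centre

variable {G : Type} [Group G] [TopologicalSpace G] [IsTopologicalGroup G] [CompactSpace G]
  [MeasurableSpace G] [BorelSpace G]

/-- **Centre-smeared minus base-point-smeared series `→ 0`.**  `MomentBounds6` constants `(C, β₄, ℓ₄)`; couplings
`β_k ≥ β₄` with `0 < a(β_k) ≤ 1/24`, `a(β_k) ≤ ℓ₄`, `a(β_k) → 0`; states `μ_k ∈ oddTorusLimitPoints r (β_k)`;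
constant shifts `c k` with `‖c k l‖ ≤ a(β_k)` (plaquette-centre offsets qualify); `n ≥ 2`, valid `q`, `F ∈ ⁰𝒮ₙ`:
`Σ'ₓ W_{μ_k}(q,x)·F(a_k·x + c k) − Σ'ₓ W_{μ_k}(q,x)·F(a_k·x) → 0`. [folklore] -/
theorem tendsto_tsum_shift_sub_base (r : LatticeRep G) {a : ℝ → ℝ} {C β₄ ℓ₄ : ℝ} (hℓ : 0 < ℓ₄) (hC : 0 ≤ C)
    (Hcol : ∀ β : ℝ, β₄ ≤ β →
      ∀ (L n : ℕ) (q : Fin n → Fin 4 × Fin 4) (x : Fin n → (Fin 4 → ℤ)) (R : ℕ), (∀ i, (q i).1 < (q i).2) →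
        1 ≤ R → (R : ℝ) * a β ≤ ℓ₄ → 4 * R + 8 ≤ L →
        (∀ i j : Fin n, i ≠ j → ∃ k : Fin 4,
          (2 * (R : ℤ) + 4) ≤ |((((x i k - x j k : ℤ) : ZMod (2 * L + 1))).valMinAbs : ℤ)|) →
        |torusE G r β L (fun U => ∏ i, (plane G r (q i) (x i) U - torusE G r β L (plane G r (q i) (x i))))| ≤
          (C / (R : ℝ) ^ 4) ^ n)
    (β : ℕ → ℝ) (hβ : ∀ k, β₄ ≤ β k) (ha : ∀ k, 0 < a (β k)) (ha24 : ∀ k, a (β k) ≤ 1 / 24)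
    (haℓ : ∀ k, a (β k) ≤ ℓ₄) (ha0 : Tendsto (fun k => a (β k)) atTop (𝓝 0))
    (μ : ℕ → Measure (LGConfig 4 G)) (hμ : ∀ k, μ k ∈ oddTorusLimitPoints r (β k))
    {n : ℕ} (hn : 2 ≤ n) (q : Fin n → Fin 4 × Fin 4) (hq : ∀ i, (q i).1 < (q i).2)
    (c : ℕ → Fin n → EuclideanSpace ℝ (Fin 4)) (hc : ∀ k l, ‖c k l‖ ≤ a (β k))
    (F : 𝓢((Fin n → EuclideanSpace ℝ (Fin 4)), ℂ)) (hF : IsOffDiagonal F) :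
    Tendsto (fun k => ∑' x : Fin n → Site 4,
        (((∫ U, ∏ i, (plane G r (q i) (x i) U - ∫ V, plane G r (q i) (x i) V ∂(μ k)) ∂(μ k) : ℝ) : ℂ)) *
          F (fun l => a (β k) • siteToE (x l) + c k l) -
      ∑' x : Fin n → Site 4,
        (((∫ U, ∏ i, (plane G r (q i) (x i) U - ∫ V, plane G r (q i) (x i) V ∂(μ k)) ∂(μ k) : ℝ) : ℂ)) *
          F (fun l => a (β k) • siteToE (x l))) atTop (𝓝 0) := by
  obtain ⟨Cp, hCp⟩ := exists_abs_plane_le (G := G) r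
  have hCp0 : 0 ≤ Cp := le_trans (abs_nonneg _) (hCp (0, 1) 0 (fun _ => 1))
  haveI : ∀ k, IsProbabilityMeasure (μ k) := fun k => by
    obtain ⟨S', -, hlim⟩ := hμ k
    exact hlim.1
  have ha1 : ∀ k, a (β k) ≤ 1 := fun k => (ha24 k).trans (by norm_num)
  set KK : ℝ := (((Cp + Cp) * 4 ^ 4 * 5 ^ 6 + (Cp + Cp) * 2 ^ 6 * (10 + 2 * (0 + 1)) ^ 4 +
      16 * C * 2 ^ 6 * (2 / ℓ₄ + 48) ^ 4) * 2 ^ 6 * (81 * ∑' m : ℕ, (((m : ℝ) + 1) ^ 2)⁻¹)) ^ n with hKK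
  have hKK0 : 0 ≤ KK := by
    have : 0 ≤ ∑' m : ℕ, (((m : ℝ) + 1) ^ 2)⁻¹ := tsum_nonneg fun m => by positivity
    positivity
  -- the shift defect at level `k` is at most `2 ‖c k‖ KK (5 ‖F‖)`
  have hdef : ∀ k, ‖∑' x : Fin n → Site 4,
        (((∫ U, ∏ i, (plane G r (q i) (x i) U - ∫ V, plane G r (q i) (x i) V ∂(μ k)) ∂(μ k) : ℝ) : ℂ)) *
          F (fun l => a (β k) • siteToE (x l) + c k l) -
      ∑' x : Fin n → Site 4,
        (((∫ U, ∏ i, (plane G r (q i) (x i) U - ∫ V, plane G r (q i) (x i) V ∂(μ k)) ∂(μ k) : ℝ) : ℂ)) *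
          F (fun l => a (β k) • siteToE (x l))‖ ≤ 2 * ‖c k‖ * KK * (5 * schwartzNorm (10 * n + 1) F) := by
    intro k
    have h := norm_tsum_weight_shift_sub_le_of_zdCollar (s₁ := 0) (s₂ := 1) hℓ hC
      (by positivity : 0 ≤ Cp + Cp)
      (fun x => ∫ U, ∏ i, (plane G r (q i) (x i) U - ∫ V, plane G r (q i) (x i) V ∂(μ k)) ∂(μ k))
      (fun x => abs_infVolWeight_le r hCp (μ k) q x)
      (fun x R hR hRa hsep => momentBounds6_oddTorusLimitPoints r Hcol (hβ k) (hμ k) q x R hq hR hRa hsep)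
      (ha k) (ha1 k) (haℓ k) hn le_rfl zero_le_one (by norm_num) (by linarith [ha24 k]) F hF
      (fun x l => a (β k) • siteToE (x l)) (fun x l => by simp) (c k) (fun l => by rw [one_mul]; exact hc k l)
    have heq : ∀ x : Fin n → Site 4, ((fun l => a (β k) • siteToE (x l)) + c k) =
        fun l => a (β k) • siteToE (x l) + c k l := fun x => by
      funext l; simp only [Pi.add_apply]
    simp only [heq] at h
    exact h
  -- `‖c k‖ ≤ a (β k) → 0`
  have hck : ∀ k, ‖c k‖ ≤ a (β k) := fun k => by
    refine (pi_norm_le_iff_of_nonneg (ha k).le).2 fun l => hc k l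
  rw [NormedAddGroup.tendsto_nhds_zero]
  intro ε hε
  have hlim : Tendsto (fun k => 2 * a (β k) * KK * (5 * schwartzNorm (10 * n + 1) F)) atTop (𝓝 0) := by
    have := ((ha0.const_mul 2).mul_const KK).mul_const (5 * schwartzNorm (10 * n + 1) F)
    simpa using this
  filter_upwards [(NormedAddGroup.tendsto_nhds_zero.1 hlim) ε hε] with k hk
  have hnn : 0 ≤ 2 * a (β k) * KK * (5 * schwartzNorm (10 * n + 1) F) := by
    have := schwartzNorm_nonneg (10 * n + 1) F
    have := (ha k).le
    positivity
  rw [Real.norm_of_nonneg hnn] at hk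
  calc _ ≤ 2 * ‖c k‖ * KK * (5 * schwartzNorm (10 * n + 1) F) := hdef k
    _ ≤ 2 * a (β k) * KK * (5 * schwartzNorm (10 * n + 1) F) := by
        have := schwartzNorm_nonneg (10 * n + 1) F
        gcongr
        exact hck k
    _ < ε := hk

end Centre

end Summit.QuantumFields.YangMills.Theorems.InfiniteVolume

end
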